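import Summits.Ventures.LatticeQCDFlow.Scaling.SimulatedTemperingDiffusive

/-!
HONEST FRAMING: exact (Metropolis-corrected) sampling algorithms for lattice gauge theory; figures
of merit are autocorrelation/cost numbers at stated couplings and volumes; no continuum-physics
claim.

# SimulatedTemperingComposition — "WHATEVER THE WITHIN-LEVEL DYNAMICS" AS A THEOREM: THE HYPOTHESES OF THE
# LEVEL LAW ARE PRESERVED WHEN A LEVEL UPDATE IS FOLLOWED BY ANY LEVEL-PRESERVING, TARGET-INVARIANT KERNEL
# (Mathlib `Kernel.comp`) — AND PRECEDED BY ONE: THE LEVEL'S LAG-ONE AUTOCOVARIANCE DOES NOT SEE THE ORDER — SO THE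
# DIFFUSIVE LAW HOLDS FOR THE COMPOSITE STEP EITHER WAY (lean-2 GEN-13, ours)

Venture-side (OURS).  Cell `lqcd-flow` (pub-lqcd), unit `pub-lqcd-lean-2-g13`, 2026-08-23.  The level
autocorrelation law `Scaling/SimulatedTemperingDiffusive.st_level_lagOneAutocorr_ge` quantifies over Markov
kernels `κ` on `Fin (K+1) × Ω` with (i) the exact-weight target invariant, (ii) nearest-neighbour level moves,
(iii) up / down moves dominated by the exact-weight Metropolis ratios, and its docstring READS "(ii)–(iii) hold
for a level update followed by any within-level dynamics; relaxing first gives the same level process shifted".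
This file TYPES both readings over Mathlib's kernel composition (`M ∘ₖ κ₁` = "first `κ₁`, then `M`"):

* `levelPreserving` hypothesis: `M y {lev ≠ lev y} = 0` for every `y` (the within-level sweep — heat bath,
  over-relaxation, HMC, a flow proposal with its accept/reject step, … — never changes the level);
* **`comp_apply_levelSet`** — for such `M` (Markov) and every `κ₁`: `(M ∘ₖ κ₁) z (lev⁻¹ T) = κ₁ z (lev⁻¹ T)` for
  every set `T` of levels: the composite step moves the level exactly as the level update does;
* **`comp_nearestNeighbour`**, **`comp_real_levelSet`** — hence (ii) and every level-set bound of the form (iii)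
  transfer from `κ₁` to `M ∘ₖ κ₁` ("level update, then sweep"); (i) transfers by Mathlib's `Kernel.Invariant.comp`;
* **`st_level_lagOneAutocorr_ge_comp`** — THE LEVEL LAW FOR THE COMPOSITE STEP: if `κ₁` satisfies (i)–(iii)
  for `stTarget X μ β K` and `M` is Markov, level-preserving and leaves `stTarget X μ β K` invariant, then
  `1 − 6ā_K/(K(K+2)) ≤ ρ_lev(1)` along the chain driven by `M ∘ₖ κ₁`;
* §3 level-determined observables: `kop_eq_self_of_levelPreserving` (`kop M f = f`),
  `kop_mul_of_levelPreserving` (`kop M (f·g) = f·kop M g`), **`autocov_comp_levelPreserving_after`**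
  (`autocov (M ∘ₖ L) π f 1 = autocov L π f 1`, no invariance needed) and **`autocov_comp_levelPreserving_before`**
  (`autocov (L ∘ₖ M) π f 1 = autocov L π f 1` for `π` `M`-invariant): THE ORDER OF "LEVEL UPDATE" AND "SWEEP" IS
  IMMATERIAL for the level's lag-one autocovariance;
* §4 **`st_level_lagOneAutocorr_ge_comp_before`** — the level law for `κ₁ ∘ₖ M` ("sweep, then level update").

NOT CLAIMED: mixtures; any constructed kernel; higher lags (the order does matter there in general).  Literature grade (cell
rule): bookkeeping over Mathlib (`Kernel.comp_apply'`, `Kernel.Invariant.comp`), NEW TYPING; nothing cited.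
-/

noncomputable section

open MeasureTheory ProbabilityTheory Set Filter Finset
open Summit.Ventures.LatticeQCDFlow.Scoring
open scoped ENNReal

namespace Summit.Ventures.LatticeQCDFlow.Scaling

/-! ## §1 Level sets under composition with a level-preserving kernel -/

section LevelPreserving

variable {E : Type*} [MeasurableSpace E] {lev : E → ℕ} {M κ₁ : Kernel E E} [IsMarkovKernel M]

/-- Level sets are measurable. [folklore] -/
theorem measurableSet_levelSet (hlev : Measurable lev) (T : Set ℕ) : MeasurableSet (lev ⁻¹' T) :=
  hlev T.to_countable.measurableSet

/-- A LEVEL-PRESERVING Markov kernel gives a level set full or zero mass according to the current level: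
`M y (lev⁻¹ T) = 1[lev y ∈ T]`. [ours] -/
theorem levelPreserving_apply_levelSet (hlev : Measurable lev) (hM : ∀ y, M y {y' | lev y' ≠ lev y} = 0)
    (T : Set ℕ) (y : E) : M y (lev ⁻¹' T) = (T.indicator (1 : ℕ → ℝ≥0∞)) (lev y) := by
  by_cases hT : lev y ∈ T
  · rw [Set.indicator_of_mem hT, Pi.one_apply]
    apply le_antisymm prob_le_one
    -- `{lev = lev y} ⊆ lev⁻¹ T` has full mass
    have hfull : M y {y' | lev y' = lev y} = 1 := by
      have h := measure_compl (μ := M y) ((measurableSet_levelSet hlev {lev y})) (measure_ne_top _ _)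
      have e : (lev ⁻¹' {lev y})ᶜ = {y' | lev y' ≠ lev y} := by ext y'; simp
      rw [e, hM y, measure_univ] at h
      -- `h : 0 = 1 - M y (lev⁻¹ {lev y})`
      have h1 : M y (lev ⁻¹' {lev y}) ≤ 1 := prob_le_one
      have h2 : 1 ≤ M y (lev ⁻¹' {lev y}) := by
        by_contra hlt
        push Not at hlt
        exact absurd h.symm (ne_of_gt (tsub_pos_of_lt hlt))
      exact le_antisymm h1 h2
    calc (1 : ℝ≥0∞) = M y {y' | lev y' = lev y} := hfull.symm
      _ ≤ M y (lev ⁻¹' T) := measure_mono fun y' (hy' : lev y' = lev y) => by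
          show lev y' ∈ T; rw [hy']; exact hT
  · rw [Set.indicator_of_notMem hT]
    refine le_antisymm ?_ zero_le
    calc M y (lev ⁻¹' T) ≤ M y {y' | lev y' ≠ lev y} := measure_mono fun y' (hy' : lev y' ∈ T) => by
          show lev y' ≠ lev y
          intro h; rw [h] at hy'; exact hT hy'
      _ = 0 := hM y

/-- **THE COMPOSITE STEP MOVES THE LEVEL EXACTLY AS THE LEVEL UPDATE DOES**: for a level-preserving Markov `M`
and every kernel `κ₁`, `(M ∘ₖ κ₁) z (lev⁻¹ T) = κ₁ z (lev⁻¹ T)`. [ours] -/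
theorem comp_apply_levelSet (hlev : Measurable lev) (hM : ∀ y, M y {y' | lev y' ≠ lev y} = 0) (T : Set ℕ)
    (z : E) : (M ∘ₖ κ₁) z (lev ⁻¹' T) = κ₁ z (lev ⁻¹' T) := by
  rw [Kernel.comp_apply' _ _ _ (measurableSet_levelSet hlev T)]
  simp_rw [levelPreserving_apply_levelSet hlev hM T]
  have e : (fun y => T.indicator (1 : ℕ → ℝ≥0∞) (lev y)) = (lev ⁻¹' T).indicator 1 := by
    funext y
    by_cases h : lev y ∈ T
    · rw [Set.indicator_of_mem h, Set.indicator_of_mem (show y ∈ lev ⁻¹' T from h)]; rfl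
    · rw [Set.indicator_of_notMem h, Set.indicator_of_notMem (show y ∉ lev ⁻¹' T from h)]
  rw [e, lintegral_indicator_one (measurableSet_levelSet hlev T)]

/-- (ii) transfers: nearest-neighbour level moves of `κ₁` ⇒ nearest-neighbour level moves of `M ∘ₖ κ₁`. [ours] -/
theorem comp_nearestNeighbour (hlev : Measurable lev) (hM : ∀ y, M y {y' | lev y' ≠ lev y} = 0)
    (hnn : ∀ z, ∀ᵐ y ∂(κ₁ z), |((lev y : ℕ) : ℝ) - lev z| ≤ 1) (z : E) :
    ∀ᵐ y ∂((M ∘ₖ κ₁) z), |((lev y : ℕ) : ℝ) - lev z| ≤ 1 := by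
  rw [ae_iff]
  have e : {y | ¬ |((lev y : ℕ) : ℝ) - lev z| ≤ 1} = lev ⁻¹' {n : ℕ | ¬ |((n : ℕ) : ℝ) - lev z| ≤ 1} := by
    ext y; simp
  rw [e, comp_apply_levelSet hlev hM, ← e]
  exact ae_iff.1 (hnn z)

/-- Level-set bounds transfer: `((M ∘ₖ κ₁) z).real (lev⁻¹ T) = (κ₁ z).real (lev⁻¹ T)`. [ours] -/
theorem comp_real_levelSet (hlev : Measurable lev) (hM : ∀ y, M y {y' | lev y' ≠ lev y} = 0) (T : Set ℕ)
    (z : E) : ((M ∘ₖ κ₁) z).real (lev ⁻¹' T) = (κ₁ z).real (lev ⁻¹' T) := by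
  rw [measureReal_def, measureReal_def, comp_apply_levelSet hlev hM T z]

end LevelPreserving

/-! ## §2 The level law for the composite step -/

section Law

variable {Ω : Type*} [MeasurableSpace Ω] {X : Ω → ℝ} {μ : Measure Ω} [IsProbabilityMeasure μ]
  {β : ℕ → ℝ} {K : ℕ}

/-- **THE LEVEL AUTOCORRELATION LAW FOR "LEVEL UPDATE, THEN ANY WITHIN-LEVEL DYNAMICS".**  `κ₁` a Markov kernel
on `Fin (K+1) × Ω` satisfying (i)–(iii) of `st_level_lagOneAutocorr_ge` for the exact-weight target; `M` a
Markov kernel that preserves the level (`M y {level ≠ level y} = 0`) and leaves the target invariant (e.g. any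
`μ_{β_k}`-invariant sweep applied at the current level `k`).  Then the chain driven by `M ∘ₖ κ₁` obeys
`1 − 6ā_K/(K(K+2)) ≤ ρ_lev(1)`, `ā_K = (2/(K+1))·Σ_{k<K} ∫ min(p_{β_k}, p_{β_{k+1}}) dμ`. [ours] -/
theorem st_level_lagOneAutocorr_ge_comp (hXm : Measurable X) (hXb : ∃ C, ∀ x, |X x| ≤ C) (hK : 1 ≤ K)
    (κ₁ M : Kernel (Fin (K + 1) × Ω) (Fin (K + 1) × Ω)) [IsMarkovKernel κ₁] [IsMarkovKernel M]
    (hinv : Kernel.Invariant κ₁ (stTarget X μ β K)) (hMinv : Kernel.Invariant M (stTarget X μ β K))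
    (hM : ∀ y, M y {y' | ((y'.1 : Fin (K + 1)) : ℕ) ≠ ((y.1 : Fin (K + 1)) : ℕ)} = 0)
    (hnn : ∀ z, ∀ᵐ y ∂(κ₁ z), |(((y.1 : Fin (K + 1)) : ℕ) : ℝ) - ((z.1 : Fin (K + 1)) : ℕ)| ≤ 1)
    (hup : ∀ (k : Fin (K + 1)) (x : Ω), (k : ℕ) < K →
      (κ₁ (k, x)).real {y | ((y.1 : Fin (K + 1)) : ℕ) = (k : ℕ) + 1} ≤
        min 1 ((Real.exp (β ((k : ℕ) + 1) * X x) / mgf X μ (β ((k : ℕ) + 1))) /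
          (Real.exp (β (k : ℕ) * X x) / mgf X μ (β (k : ℕ)))))
    (hdown : ∀ (k : Fin (K + 1)) (x : Ω), 1 ≤ (k : ℕ) →
      (κ₁ (k, x)).real {y | ((y.1 : Fin (K + 1)) : ℕ) + 1 = (k : ℕ)} ≤
        min 1 ((Real.exp (β ((k : ℕ) - 1) * X x) / mgf X μ (β ((k : ℕ) - 1))) /
          (Real.exp (β (k : ℕ) * X x) / mgf X μ (β (k : ℕ))))) :
    1 - 6 * (2 / (K + 1) * ∑ k ∈ range K, ∫ x, min (Real.exp (β k * X x) / mgf X μ (β k))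
        (Real.exp (β (k + 1) * X x) / mgf X μ (β (k + 1))) ∂μ) / (K * (K + 2)) ≤
      (autocov (M ∘ₖ κ₁) (stTarget X μ β K) (fun z => (((z.1 : Fin (K + 1)) : ℕ) : ℝ)) 1 - ((K : ℝ) / 2) ^ 2) /
        (K * (K + 2) / 12) := by
  have hlev : Measurable fun z : Fin (K + 1) × Ω => ((z.1 : Fin (K + 1)) : ℕ) := measurable_stLevel
  refine st_level_lagOneAutocorr_ge hXm hXb hK (M ∘ₖ κ₁) (hMinv.comp hinv)
    (comp_nearestNeighbour (M := M) (κ₁ := κ₁) hlev hM hnn) (fun k x hk => ?_) (fun k x hk => ?_)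
  · have e : {y : Fin (K + 1) × Ω | ((y.1 : Fin (K + 1)) : ℕ) = (k : ℕ) + 1} =
        (fun z : Fin (K + 1) × Ω => ((z.1 : Fin (K + 1)) : ℕ)) ⁻¹' {(k : ℕ) + 1} := by
      ext y; simp
    rw [e, comp_real_levelSet (M := M) (κ₁ := κ₁) hlev hM, ← e]
    exact hup k x hk
  · have e : {y : Fin (K + 1) × Ω | ((y.1 : Fin (K + 1)) : ℕ) + 1 = (k : ℕ)} =
        (fun z : Fin (K + 1) × Ω => ((z.1 : Fin (K + 1)) : ℕ)) ⁻¹' {n : ℕ | n + 1 = (k : ℕ)} := by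
      ext y; simp
    rw [e, comp_real_levelSet (M := M) (κ₁ := κ₁) hlev hM, ← e]
    exact hdown k x hk

end Law

/-! ## §3 Level-determined observables: the order of "level update" and "within-level sweep" is immaterial -/

section Order

variable {E : Type*} [MeasurableSpace E] {lev : E → ℕ} {M L : Kernel E E} [IsMarkovKernel M] [IsMarkovKernel L]
  {π : Measure E} [IsProbabilityMeasure π] {f g : E → ℝ} {B C : ℝ}

/-- A level-preserving kernel FIXES every bounded measurable level-determined observable: `kop M f = f`. [ours] -/
theorem kop_eq_self_of_levelPreserving (hM : ∀ y, M y {y' | lev y' ≠ lev y} = 0)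
    (hf : ∀ y y', lev y = lev y' → f y = f y') : kop M f = f := by
  funext y
  unfold kop
  have hae : ∀ᵐ y' ∂(M y), f y' = f y := by
    rw [ae_iff]
    refine measure_mono_null (fun y' (hy' : ¬ f y' = f y) => ?_) (hM y)
    show lev y' ≠ lev y
    intro h; exact hy' (hf y' y h)
  rw [integral_congr_ae hae, integral_const, probReal_univ, one_smul]

omit [IsMarkovKernel M] in
/-- A level-preserving kernel COMMUTES with multiplication by a level-determined observable:
`kop M (f·g) = f·(kop M g)`. [ours] -/
theorem kop_mul_of_levelPreserving (hM : ∀ y, M y {y' | lev y' ≠ lev y} = 0)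
    (hf : ∀ y y', lev y = lev y' → f y = f y') (g : E → ℝ) :
    kop M (fun y => f y * g y) = fun z => f z * kop M g z := by
  funext z
  unfold kop
  have hae : ∀ᵐ y' ∂(M z), f y' * g y' = f z * g y' := by
    rw [ae_iff]
    refine measure_mono_null (fun y' (hy' : ¬ f y' * g y' = f z * g y') => ?_) (hM z)
    show lev y' ≠ lev z
    intro h; exact hy' (by rw [hf y' z h])
  rw [integral_congr_ae hae, integral_const_mul]

omit [IsProbabilityMeasure π] in
/-- **LEVEL UPDATE THEN SWEEP**: `autocov (M ∘ₖ L) π f 1 = autocov L π f 1` for every level-preserving Markov `M`,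
every Markov `L`, every bounded measurable level-determined `f` (no invariance needed). [ours] -/
theorem autocov_comp_levelPreserving_after (hM : ∀ y, M y {y' | lev y' ≠ lev y} = 0)
    (hfm : Measurable f) (hfb : ∀ y, |f y| ≤ B) (hf : ∀ y y', lev y = lev y' → f y = f y') :
    autocov (M ∘ₖ L) π f 1 = autocov L π f 1 := by
  simp only [autocov, Function.iterate_one]
  rw [kop_comp L M hfm hfb, kop_eq_self_of_levelPreserving hM hf]

/-- **SWEEP THEN LEVEL UPDATE**: `autocov (L ∘ₖ M) π f 1 = autocov L π f 1` for every level-preserving Markov `M`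
leaving `π` invariant, every Markov `L`, every bounded measurable level-determined `f`. [ours] -/
theorem autocov_comp_levelPreserving_before (hπM : Kernel.Invariant M π)
    (hM : ∀ y, M y {y' | lev y' ≠ lev y} = 0) (hfm : Measurable f) (hfb : ∀ y, |f y| ≤ B)
    (hf : ∀ y y', lev y = lev y' → f y = f y') :
    autocov (L ∘ₖ M) π f 1 = autocov L π f 1 := by
  simp only [autocov, Function.iterate_one]
  have hLf := iterate_kop_bounded_measurable L hfm hfb 1
  simp only [Function.iterate_one] at hLf
  rw [kop_comp M L hfm hfb]
  have e : (fun x => f x * kop M (kop L f) x) = kop M (fun y => f y * kop L f y) :=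
    (kop_mul_of_levelPreserving hM hf (kop L f)).symm
  rw [e]
  refine integral_kop M hπM (hfm.mul hLf.1) (C := B * B) fun x => ?_
  rw [abs_mul]
  exact mul_le_mul (hfb x) (hLf.2 x) (abs_nonneg _) ((abs_nonneg _).trans (hfb x))

end Order

/-! ## §4 The level law for the composite step in EITHER order -/

section LawBefore

variable {Ω : Type*} [MeasurableSpace Ω] {X : Ω → ℝ} {μ : Measure Ω} [IsProbabilityMeasure μ]
  {β : ℕ → ℝ} {K : ℕ}

/-- **THE LEVEL AUTOCORRELATION LAW FOR "ANY WITHIN-LEVEL DYNAMICS, THEN LEVEL UPDATE".**  `κ₁` a Markov kernel on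
`Fin (K+1) × Ω` satisfying (i)–(iii) of `st_level_lagOneAutocorr_ge`; `M` Markov, level-preserving, leaving the
exact-weight target invariant.  Then the chain driven by `κ₁ ∘ₖ M` (first `M`, then `κ₁`) has the SAME lag-one level
autocovariance as the chain driven by `κ₁`, hence `1 − 6ā_K/(K(K+2)) ≤ ρ_lev(1)`. [ours] -/
theorem st_level_lagOneAutocorr_ge_comp_before (hXm : Measurable X) (hXb : ∃ C, ∀ x, |X x| ≤ C) (hK : 1 ≤ K)
    (κ₁ M : Kernel (Fin (K + 1) × Ω) (Fin (K + 1) × Ω)) [IsMarkovKernel κ₁] [IsMarkovKernel M]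
    (hinv : Kernel.Invariant κ₁ (stTarget X μ β K)) (hMinv : Kernel.Invariant M (stTarget X μ β K))
    (hM : ∀ y, M y {y' | ((y'.1 : Fin (K + 1)) : ℕ) ≠ ((y.1 : Fin (K + 1)) : ℕ)} = 0)
    (hnn : ∀ z, ∀ᵐ y ∂(κ₁ z), |(((y.1 : Fin (K + 1)) : ℕ) : ℝ) - ((z.1 : Fin (K + 1)) : ℕ)| ≤ 1)
    (hup : ∀ (k : Fin (K + 1)) (x : Ω), (k : ℕ) < K →
      (κ₁ (k, x)).real {y | ((y.1 : Fin (K + 1)) : ℕ) = (k : ℕ) + 1} ≤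
        min 1 ((Real.exp (β ((k : ℕ) + 1) * X x) / mgf X μ (β ((k : ℕ) + 1))) /
          (Real.exp (β (k : ℕ) * X x) / mgf X μ (β (k : ℕ)))))
    (hdown : ∀ (k : Fin (K + 1)) (x : Ω), 1 ≤ (k : ℕ) →
      (κ₁ (k, x)).real {y | ((y.1 : Fin (K + 1)) : ℕ) + 1 = (k : ℕ)} ≤
        min 1 ((Real.exp (β ((k : ℕ) - 1) * X x) / mgf X μ (β ((k : ℕ) - 1))) /
          (Real.exp (β (k : ℕ) * X x) / mgf X μ (β (k : ℕ))))) :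
    1 - 6 * (2 / (K + 1) * ∑ k ∈ range K, ∫ x, min (Real.exp (β k * X x) / mgf X μ (β k))
        (Real.exp (β (k + 1) * X x) / mgf X μ (β (k + 1))) ∂μ) / (K * (K + 2)) ≤
      (autocov (κ₁ ∘ₖ M) (stTarget X μ β K) (fun z => (((z.1 : Fin (K + 1)) : ℕ) : ℝ)) 1 - ((K : ℝ) / 2) ^ 2) /
        (K * (K + 2) / 12) := by
  haveI := isProbabilityMeasure_stTarget (μ := μ) (β := β) (K := K) hXm hXb
  have hfm : Measurable fun z : Fin (K + 1) × Ω => (((z.1 : Fin (K + 1)) : ℕ) : ℝ) :=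
    measurable_from_nat.comp measurable_stLevel
  rw [autocov_comp_levelPreserving_before (lev := fun z : Fin (K + 1) × Ω => ((z.1 : Fin (K + 1)) : ℕ))
    (f := fun z : Fin (K + 1) × Ω => (((z.1 : Fin (K + 1)) : ℕ) : ℝ)) (L := κ₁) hMinv hM hfm (B := K)
    (fun z => abs_level_le (fun z : Fin (K + 1) × Ω => Nat.le_of_lt_succ z.1.isLt) z)
    (fun y y' h => by simp only [h])]
  exact st_level_lagOneAutocorr_ge hXm hXb hK κ₁ hinv hnn hup hdown

end LawBefore

end Summit.Ventures.LatticeQCDFlow.Scaling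

end
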